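import Summits.CriticalPhenomena.PercolationContinuityZ3.Theorems.PercNearOneGluingNoHeavyLowerTailForestRayleighTwoSumReal
import HarnessLib

/-!
# Weighted forest negative correlation — 2-sums II: `e, f` on the same side of the separation

Notation (`…ForestRayleighTools`, `…TwoSeparation*`, `…TwoSumReal`): `Z(D;K) = Σ_{G ⊆ D, ⟨G ∪ K⟩ acyclic} ∏ w`,
`(R)(D;K;e,f) : Z(D;K∪{e,f})·Z(D;K) ≤ Z(D;K∪e)·Z(D;K∪f)`; sides `D₁,K₁` (edges on `S₁`) and
`D₂,K₂` (edges on `S₂`), `S₁ ∩ S₂ ⊆ {s,t}`, marker `m = st` on neither side.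

For the glued instance `(D₁ ∪ D₂ [∪ m]; K₁ ∪ K₂ [∪ m]; e, f)` the Rayleigh inequality follows from
Rayleigh inequalities of the sides with the marker adjoined (stated exactly as instances of `(R)`
for the sides, so that the 2-sum theorem `…ForestRayleighTwoSum` can feed them), case by case:
`lsm_sep_same` / `lsm_sep_same_free` / `lsm_sep_same_pin` (`e, f` on one side; marker absent /
free / pinned), `lsm_sep_split` / `lsm_sep_split_free` / `lsm_sep_split_pin` (`e`, `f` on
different sides); the case `e = m` is `lsm_sep_marker` in `…TwoSumReal`. [Semple–Welsh, CPC 17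
(2008) §5 Question 2; the 2-sum theorem of Cocks and of Wagner (2008) for matroids — graphic case,
elementary proof via the two-state decomposition `forestsW_sep`] Theorems only; no definitions,
no `sorry`.
-/

open Finset SimpleGraph
open scoped Classical

namespace Summit.CriticalPhenomena.PercolationContinuityZ3.Theorems.ForestRayleigh

variable {V : Type*} [Fintype V] [DecidableEq V]

/-! ### §1 `e, f` on the same side -/

/-- **2-sum, `e,f` on side 1, marker absent.** `(R)(D₁∪D₂; K₁∪K₂; e,f)` from the one-parameter
family `(R)(D₁ ∪ m; K₁; e,f)` with the marker free of activity `λ ≥ 0`, and `(R)(D₁; K₁ ∪ m; e,f)`.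
[S–W 2008 §5 Q.2, graphic case] -/
theorem lsm_sep_same (w : Sym2 V → ℝ) (hw : ∀ x, 0 ≤ w x) {D₁ K₁ D₂ K₂ : Finset (Sym2 V)}
    {S₁ S₂ : Set V} {s t : V} (e f : Sym2 V)
    (h₁ : ∀ z ∈ D₁ ∪ insert e (insert f K₁), ∀ x ∈ z, x ∈ S₁) (h₂ : ∀ z ∈ D₂ ∪ K₂, ∀ x ∈ z, x ∈ S₂)
    (hS : ∀ x, x ∈ S₁ → x ∈ S₂ → x = s ∨ x = t) (hst : s ≠ t)
    (hL₁ : ∀ z ∈ D₁ ∪ insert e (insert f K₁), ¬z.IsDiag) (hL₂ : ∀ z ∈ D₂ ∪ K₂, ¬z.IsDiag)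
    (hm₁ : s(s, t) ∉ D₁ ∪ insert e (insert f K₁)) (hm₂ : s(s, t) ∉ D₂ ∪ K₂) (hD : Disjoint D₁ D₂)
    (hlamRaw : ∀ lam : ℝ, 0 ≤ lam →
      (∑ G ∈ (insert s(s, t) D₁).powerset.filter (fun G =>
        (fromEdgeSet ((G ∪ (insert e (insert f K₁)) : Finset (Sym2 V)) : Set (Sym2 V))).IsAcyclic), ∏ x ∈ G, Function.update w s(s, t) lam x) *
      (∑ G ∈ (insert s(s, t) D₁).powerset.filter (fun G =>
        (fromEdgeSet ((G ∪ (K₁) : Finset (Sym2 V)) : Set (Sym2 V))).IsAcyclic), ∏ x ∈ G, Function.update w s(s, t) lam x) ≤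
      (∑ G ∈ (insert s(s, t) D₁).powerset.filter (fun G =>
        (fromEdgeSet ((G ∪ (insert e K₁) : Finset (Sym2 V)) : Set (Sym2 V))).IsAcyclic), ∏ x ∈ G, Function.update w s(s, t) lam x) *
      (∑ G ∈ (insert s(s, t) D₁).powerset.filter (fun G =>
        (fromEdgeSet ((G ∪ (insert f K₁) : Finset (Sym2 V)) : Set (Sym2 V))).IsAcyclic), ∏ x ∈ G, Function.update w s(s, t) lam x))
    (hpinRaw : (∑ G ∈ D₁.powerset.filter (fun G =>
        (fromEdgeSet ((G ∪ (insert e (insert f (insert s(s, t) K₁))) : Finset (Sym2 V)) : Set (Sym2 V))).IsAcyclic), ∏ x ∈ G, w x) *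
      (∑ G ∈ D₁.powerset.filter (fun G =>
        (fromEdgeSet ((G ∪ (insert s(s, t) K₁) : Finset (Sym2 V)) : Set (Sym2 V))).IsAcyclic), ∏ x ∈ G, w x) ≤
      (∑ G ∈ D₁.powerset.filter (fun G =>
        (fromEdgeSet ((G ∪ (insert e (insert s(s, t) K₁)) : Finset (Sym2 V)) : Set (Sym2 V))).IsAcyclic), ∏ x ∈ G, w x) *
      (∑ G ∈ D₁.powerset.filter (fun G =>
        (fromEdgeSet ((G ∪ (insert f (insert s(s, t) K₁)) : Finset (Sym2 V)) : Set (Sym2 V))).IsAcyclic), ∏ x ∈ G, w x)) :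
    (∑ G ∈ (D₁ ∪ D₂).powerset.filter (fun G =>
        (fromEdgeSet ((G ∪ (insert e (insert f (K₁ ∪ K₂))) : Finset (Sym2 V)) : Set (Sym2 V))).IsAcyclic), ∏ x ∈ G, w x) *
      (∑ G ∈ (D₁ ∪ D₂).powerset.filter (fun G =>
        (fromEdgeSet ((G ∪ (K₁ ∪ K₂) : Finset (Sym2 V)) : Set (Sym2 V))).IsAcyclic), ∏ x ∈ G, w x) ≤
    (∑ G ∈ (D₁ ∪ D₂).powerset.filter (fun G =>
        (fromEdgeSet ((G ∪ (insert e (K₁ ∪ K₂)) : Finset (Sym2 V)) : Set (Sym2 V))).IsAcyclic), ∏ x ∈ G, w x) *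
      (∑ G ∈ (D₁ ∪ D₂).powerset.filter (fun G =>
        (fromEdgeSet ((G ∪ (insert f (K₁ ∪ K₂)) : Finset (Sym2 V)) : Set (Sym2 V))).IsAcyclic), ∏ x ∈ G, w x) := by
  have hmD₁ : s(s, t) ∉ D₁ := fun h => hm₁ (Finset.mem_union_left _ h)
  have hlam : ∀ lam : ℝ, 0 ≤ lam →
      ((∑ G ∈ D₁.powerset.filter (fun G =>
        (fromEdgeSet ((G ∪ (insert e (insert f K₁)) : Finset (Sym2 V)) : Set (Sym2 V))).IsAcyclic), ∏ x ∈ G, w x) +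
        lam * (∑ G ∈ D₁.powerset.filter (fun G =>
        (fromEdgeSet ((G ∪ (insert s(s, t) (insert e (insert f K₁))) : Finset (Sym2 V)) : Set (Sym2 V))).IsAcyclic), ∏ x ∈ G, w x)) *
      ((∑ G ∈ D₁.powerset.filter (fun G =>
        (fromEdgeSet ((G ∪ (K₁) : Finset (Sym2 V)) : Set (Sym2 V))).IsAcyclic), ∏ x ∈ G, w x) +
        lam * (∑ G ∈ D₁.powerset.filter (fun G =>
        (fromEdgeSet ((G ∪ (insert s(s, t) K₁) : Finset (Sym2 V)) : Set (Sym2 V))).IsAcyclic), ∏ x ∈ G, w x)) ≤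
      ((∑ G ∈ D₁.powerset.filter (fun G =>
        (fromEdgeSet ((G ∪ (insert e K₁) : Finset (Sym2 V)) : Set (Sym2 V))).IsAcyclic), ∏ x ∈ G, w x) +
        lam * (∑ G ∈ D₁.powerset.filter (fun G =>
        (fromEdgeSet ((G ∪ (insert s(s, t) (insert e K₁)) : Finset (Sym2 V)) : Set (Sym2 V))).IsAcyclic), ∏ x ∈ G, w x)) *
      ((∑ G ∈ D₁.powerset.filter (fun G =>
        (fromEdgeSet ((G ∪ (insert f K₁) : Finset (Sym2 V)) : Set (Sym2 V))).IsAcyclic), ∏ x ∈ G, w x) +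
        lam * (∑ G ∈ D₁.powerset.filter (fun G =>
        (fromEdgeSet ((G ∪ (insert s(s, t) (insert f K₁)) : Finset (Sym2 V)) : Set (Sym2 V))).IsAcyclic), ∏ x ∈ G, w x)) := by
    intro lam hl
    have h := hlamRaw lam hl
    rw [forestsW_insert_split _ D₁ _ hmD₁, forestsW_insert_split _ D₁ _ hmD₁,
      forestsW_insert_split _ D₁ _ hmD₁, forestsW_insert_split _ D₁ _ hmD₁] at h
    simp only [forestsW_update w D₁ _ s(s, t) lam hmD₁, Function.update_self] at h
    exact h
  have hpin : (∑ G ∈ D₁.powerset.filter (fun G =>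
        (fromEdgeSet ((G ∪ (insert s(s, t) (insert e (insert f K₁))) : Finset (Sym2 V)) : Set (Sym2 V))).IsAcyclic), ∏ x ∈ G, w x) *
      (∑ G ∈ D₁.powerset.filter (fun G =>
        (fromEdgeSet ((G ∪ (insert s(s, t) K₁) : Finset (Sym2 V)) : Set (Sym2 V))).IsAcyclic), ∏ x ∈ G, w x) ≤
      (∑ G ∈ D₁.powerset.filter (fun G =>
        (fromEdgeSet ((G ∪ (insert s(s, t) (insert e K₁)) : Finset (Sym2 V)) : Set (Sym2 V))).IsAcyclic), ∏ x ∈ G, w x) *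
      (∑ G ∈ D₁.powerset.filter (fun G =>
        (fromEdgeSet ((G ∪ (insert s(s, t) (insert f K₁)) : Finset (Sym2 V)) : Set (Sym2 V))).IsAcyclic), ∏ x ∈ G, w x) := by
    have e₁ : insert e (insert f (insert s(s, t) K₁)) = insert s(s, t) (insert e (insert f K₁)) := by
      ext z; simp only [Finset.mem_insert]; tauto
    have e₂ : insert e (insert s(s, t) K₁) = insert s(s, t) (insert e K₁) := Finset.insert_comm _ _ _
    have e₃ : insert f (insert s(s, t) K₁) = insert s(s, t) (insert f K₁) := Finset.insert_comm _ _ _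
    have h := hpinRaw
    simp only [e₁] at h
    simp only [e₂, e₃] at h
    exact h
  have hset₁ : insert e (insert f (K₁ ∪ K₂)) = insert e (insert f K₁) ∪ K₂ := by
    rw [Finset.insert_union, Finset.insert_union]
  have hset₂ : insert e (K₁ ∪ K₂) = insert e K₁ ∪ K₂ := by rw [Finset.insert_union]
  have hset₃ : insert f (K₁ ∪ K₂) = insert f K₁ ∪ K₂ := by rw [Finset.insert_union]
  have sK : D₁ ∪ K₁ ⊆ D₁ ∪ insert e (insert f K₁) := Finset.union_subset_union (subset_refl _)
    ((Finset.subset_insert f K₁).trans (Finset.subset_insert e _))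
  have sE : D₁ ∪ insert e K₁ ⊆ D₁ ∪ insert e (insert f K₁) := Finset.union_subset_union
    (subset_refl _) (Finset.insert_subset_insert e (Finset.subset_insert f K₁))
  have sF : D₁ ∪ insert f K₁ ⊆ D₁ ∪ insert e (insert f K₁) := Finset.union_subset_union
    (subset_refl _) (Finset.subset_insert e _)
  simp only [hset₁]
  simp only [hset₂, hset₃]
  rw [forestsW_sep w h₁ h₂ hS hst hL₁ hL₂
      hm₁ hm₂ hD,
    forestsW_sep w (forall_mem_mono sK h₁) h₂ hS hst (forall_mem_mono sK hL₁) hL₂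
      (fun h => hm₁ (sK h)) hm₂ hD,
    forestsW_sep w (forall_mem_mono sE h₁) h₂ hS hst (forall_mem_mono sE hL₁) hL₂
      (fun h => hm₁ (sE h)) hm₂ hD,
    forestsW_sep w (forall_mem_mono sF h₁) h₂ hS hst (forall_mem_mono sF hL₁) hL₂
      (fun h => hm₁ (sF h)) hm₂ hD]
  exact real_sep_same₀ (forestsW_nonneg w hw D₂ _) (forestsW_insert_pin_le w hw D₂ K₂ _) hlam hpin

/-- **2-sum, `e,f` on side 1, marker free.** `(R)(D₁∪D₂∪m; K₁∪K₂; e,f)` from the same two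
side-1 inputs as `lsm_sep_same`. [S–W 2008 §5 Q.2, graphic case] -/
theorem lsm_sep_same_free (w : Sym2 V → ℝ) (hw : ∀ x, 0 ≤ w x) {D₁ K₁ D₂ K₂ : Finset (Sym2 V)}
    {S₁ S₂ : Set V} {s t : V} (e f : Sym2 V)
    (h₁ : ∀ z ∈ D₁ ∪ insert e (insert f K₁), ∀ x ∈ z, x ∈ S₁) (h₂ : ∀ z ∈ D₂ ∪ K₂, ∀ x ∈ z, x ∈ S₂)
    (hS : ∀ x, x ∈ S₁ → x ∈ S₂ → x = s ∨ x = t) (hst : s ≠ t)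
    (hL₁ : ∀ z ∈ D₁ ∪ insert e (insert f K₁), ¬z.IsDiag) (hL₂ : ∀ z ∈ D₂ ∪ K₂, ¬z.IsDiag)
    (hm₁ : s(s, t) ∉ D₁ ∪ insert e (insert f K₁)) (hm₂ : s(s, t) ∉ D₂ ∪ K₂) (hD : Disjoint D₁ D₂)
    (hlamRaw : ∀ lam : ℝ, 0 ≤ lam →
      (∑ G ∈ (insert s(s, t) D₁).powerset.filter (fun G =>
        (fromEdgeSet ((G ∪ (insert e (insert f K₁)) : Finset (Sym2 V)) : Set (Sym2 V))).IsAcyclic), ∏ x ∈ G, Function.update w s(s, t) lam x) *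
      (∑ G ∈ (insert s(s, t) D₁).powerset.filter (fun G =>
        (fromEdgeSet ((G ∪ (K₁) : Finset (Sym2 V)) : Set (Sym2 V))).IsAcyclic), ∏ x ∈ G, Function.update w s(s, t) lam x) ≤
      (∑ G ∈ (insert s(s, t) D₁).powerset.filter (fun G =>
        (fromEdgeSet ((G ∪ (insert e K₁) : Finset (Sym2 V)) : Set (Sym2 V))).IsAcyclic), ∏ x ∈ G, Function.update w s(s, t) lam x) *
      (∑ G ∈ (insert s(s, t) D₁).powerset.filter (fun G =>
        (fromEdgeSet ((G ∪ (insert f K₁) : Finset (Sym2 V)) : Set (Sym2 V))).IsAcyclic), ∏ x ∈ G, Function.update w s(s, t) lam x))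
    (hpinRaw : (∑ G ∈ D₁.powerset.filter (fun G =>
        (fromEdgeSet ((G ∪ (insert e (insert f (insert s(s, t) K₁))) : Finset (Sym2 V)) : Set (Sym2 V))).IsAcyclic), ∏ x ∈ G, w x) *
      (∑ G ∈ D₁.powerset.filter (fun G =>
        (fromEdgeSet ((G ∪ (insert s(s, t) K₁) : Finset (Sym2 V)) : Set (Sym2 V))).IsAcyclic), ∏ x ∈ G, w x) ≤
      (∑ G ∈ D₁.powerset.filter (fun G =>
        (fromEdgeSet ((G ∪ (insert e (insert s(s, t) K₁)) : Finset (Sym2 V)) : Set (Sym2 V))).IsAcyclic), ∏ x ∈ G, w x) *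
      (∑ G ∈ D₁.powerset.filter (fun G =>
        (fromEdgeSet ((G ∪ (insert f (insert s(s, t) K₁)) : Finset (Sym2 V)) : Set (Sym2 V))).IsAcyclic), ∏ x ∈ G, w x)) :
    (∑ G ∈ (insert s(s, t) (D₁ ∪ D₂)).powerset.filter (fun G =>
        (fromEdgeSet ((G ∪ (insert e (insert f (K₁ ∪ K₂))) : Finset (Sym2 V)) : Set (Sym2 V))).IsAcyclic), ∏ x ∈ G, w x) *
      (∑ G ∈ (insert s(s, t) (D₁ ∪ D₂)).powerset.filter (fun G =>
        (fromEdgeSet ((G ∪ (K₁ ∪ K₂) : Finset (Sym2 V)) : Set (Sym2 V))).IsAcyclic), ∏ x ∈ G, w x) ≤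
    (∑ G ∈ (insert s(s, t) (D₁ ∪ D₂)).powerset.filter (fun G =>
        (fromEdgeSet ((G ∪ (insert e (K₁ ∪ K₂)) : Finset (Sym2 V)) : Set (Sym2 V))).IsAcyclic), ∏ x ∈ G, w x) *
      (∑ G ∈ (insert s(s, t) (D₁ ∪ D₂)).powerset.filter (fun G =>
        (fromEdgeSet ((G ∪ (insert f (K₁ ∪ K₂)) : Finset (Sym2 V)) : Set (Sym2 V))).IsAcyclic), ∏ x ∈ G, w x) := by
  have hmD₁ : s(s, t) ∉ D₁ := fun h => hm₁ (Finset.mem_union_left _ h)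
  have hlam : ∀ lam : ℝ, 0 ≤ lam →
      ((∑ G ∈ D₁.powerset.filter (fun G =>
        (fromEdgeSet ((G ∪ (insert e (insert f K₁)) : Finset (Sym2 V)) : Set (Sym2 V))).IsAcyclic), ∏ x ∈ G, w x) +
        lam * (∑ G ∈ D₁.powerset.filter (fun G =>
        (fromEdgeSet ((G ∪ (insert s(s, t) (insert e (insert f K₁))) : Finset (Sym2 V)) : Set (Sym2 V))).IsAcyclic), ∏ x ∈ G, w x)) *
      ((∑ G ∈ D₁.powerset.filter (fun G =>
        (fromEdgeSet ((G ∪ (K₁) : Finset (Sym2 V)) : Set (Sym2 V))).IsAcyclic), ∏ x ∈ G, w x) +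
        lam * (∑ G ∈ D₁.powerset.filter (fun G =>
        (fromEdgeSet ((G ∪ (insert s(s, t) K₁) : Finset (Sym2 V)) : Set (Sym2 V))).IsAcyclic), ∏ x ∈ G, w x)) ≤
      ((∑ G ∈ D₁.powerset.filter (fun G =>
        (fromEdgeSet ((G ∪ (insert e K₁) : Finset (Sym2 V)) : Set (Sym2 V))).IsAcyclic), ∏ x ∈ G, w x) +
        lam * (∑ G ∈ D₁.powerset.filter (fun G =>
        (fromEdgeSet ((G ∪ (insert s(s, t) (insert e K₁)) : Finset (Sym2 V)) : Set (Sym2 V))).IsAcyclic), ∏ x ∈ G, w x)) *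
      ((∑ G ∈ D₁.powerset.filter (fun G =>
        (fromEdgeSet ((G ∪ (insert f K₁) : Finset (Sym2 V)) : Set (Sym2 V))).IsAcyclic), ∏ x ∈ G, w x) +
        lam * (∑ G ∈ D₁.powerset.filter (fun G =>
        (fromEdgeSet ((G ∪ (insert s(s, t) (insert f K₁)) : Finset (Sym2 V)) : Set (Sym2 V))).IsAcyclic), ∏ x ∈ G, w x)) := by
    intro lam hl
    have h := hlamRaw lam hl
    rw [forestsW_insert_split _ D₁ _ hmD₁, forestsW_insert_split _ D₁ _ hmD₁,
      forestsW_insert_split _ D₁ _ hmD₁, forestsW_insert_split _ D₁ _ hmD₁] at h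
    simp only [forestsW_update w D₁ _ s(s, t) lam hmD₁, Function.update_self] at h
    exact h
  have hpin : (∑ G ∈ D₁.powerset.filter (fun G =>
        (fromEdgeSet ((G ∪ (insert s(s, t) (insert e (insert f K₁))) : Finset (Sym2 V)) : Set (Sym2 V))).IsAcyclic), ∏ x ∈ G, w x) *
      (∑ G ∈ D₁.powerset.filter (fun G =>
        (fromEdgeSet ((G ∪ (insert s(s, t) K₁) : Finset (Sym2 V)) : Set (Sym2 V))).IsAcyclic), ∏ x ∈ G, w x) ≤
      (∑ G ∈ D₁.powerset.filter (fun G =>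
        (fromEdgeSet ((G ∪ (insert s(s, t) (insert e K₁)) : Finset (Sym2 V)) : Set (Sym2 V))).IsAcyclic), ∏ x ∈ G, w x) *
      (∑ G ∈ D₁.powerset.filter (fun G =>
        (fromEdgeSet ((G ∪ (insert s(s, t) (insert f K₁)) : Finset (Sym2 V)) : Set (Sym2 V))).IsAcyclic), ∏ x ∈ G, w x) := by
    have e₁ : insert e (insert f (insert s(s, t) K₁)) = insert s(s, t) (insert e (insert f K₁)) := by
      ext z; simp only [Finset.mem_insert]; tauto
    have e₂ : insert e (insert s(s, t) K₁) = insert s(s, t) (insert e K₁) := Finset.insert_comm _ _ _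
    have e₃ : insert f (insert s(s, t) K₁) = insert s(s, t) (insert f K₁) := Finset.insert_comm _ _ _
    have h := hpinRaw
    simp only [e₁] at h
    simp only [e₂, e₃] at h
    exact h
  have hset₁ : insert e (insert f (K₁ ∪ K₂)) = insert e (insert f K₁) ∪ K₂ := by
    rw [Finset.insert_union, Finset.insert_union]
  have hset₂ : insert e (K₁ ∪ K₂) = insert e K₁ ∪ K₂ := by rw [Finset.insert_union]
  have hset₃ : insert f (K₁ ∪ K₂) = insert f K₁ ∪ K₂ := by rw [Finset.insert_union]
  have sK : D₁ ∪ K₁ ⊆ D₁ ∪ insert e (insert f K₁) := Finset.union_subset_union (subset_refl _)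
    ((Finset.subset_insert f K₁).trans (Finset.subset_insert e _))
  have sE : D₁ ∪ insert e K₁ ⊆ D₁ ∪ insert e (insert f K₁) := Finset.union_subset_union
    (subset_refl _) (Finset.insert_subset_insert e (Finset.subset_insert f K₁))
  have sF : D₁ ∪ insert f K₁ ⊆ D₁ ∪ insert e (insert f K₁) := Finset.union_subset_union
    (subset_refl _) (Finset.subset_insert e _)
  have hmD : s(s, t) ∉ D₁ ∪ D₂ := by
    rw [Finset.mem_union, not_or]
    exact ⟨fun h => hm₁ (Finset.mem_union_left _ h), fun h => hm₂ (Finset.mem_union_left _ h)⟩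
  simp only [hset₁]
  simp only [hset₂, hset₃]
  rw [forestsW_insert_split w (D₁ ∪ D₂) (insert e (insert f K₁) ∪ K₂) hmD,
    forestsW_insert_split w (D₁ ∪ D₂) (K₁ ∪ K₂) hmD,
    forestsW_insert_split w (D₁ ∪ D₂) (insert e K₁ ∪ K₂) hmD,
    forestsW_insert_split w (D₁ ∪ D₂) (insert f K₁ ∪ K₂) hmD,
    forestsW_sep w h₁ h₂ hS hst hL₁ hL₂
      hm₁ hm₂ hD,
    forestsW_sep w (forall_mem_mono sK h₁) h₂ hS hst (forall_mem_mono sK hL₁) hL₂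
      (fun h => hm₁ (sK h)) hm₂ hD,
    forestsW_sep w (forall_mem_mono sE h₁) h₂ hS hst (forall_mem_mono sE hL₁) hL₂
      (fun h => hm₁ (sE h)) hm₂ hD,
    forestsW_sep w (forall_mem_mono sF h₁) h₂ hS hst (forall_mem_mono sF hL₁) hL₂
      (fun h => hm₁ (sF h)) hm₂ hD,
    forestsW_sep_pin w h₁ h₂ hS hst hL₁ hL₂
      hm₁ hm₂ hD,
    forestsW_sep_pin w (forall_mem_mono sK h₁) h₂ hS hst (forall_mem_mono sK hL₁) hL₂
      (fun h => hm₁ (sK h)) hm₂ hD,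
    forestsW_sep_pin w (forall_mem_mono sE h₁) h₂ hS hst (forall_mem_mono sE hL₁) hL₂
      (fun h => hm₁ (sE h)) hm₂ hD,
    forestsW_sep_pin w (forall_mem_mono sF h₁) h₂ hS hst (forall_mem_mono sF hL₁) hL₂
      (fun h => hm₁ (sF h)) hm₂ hD]
  exact real_sep_same (hw _) (forestsW_nonneg w hw D₂ _) (forestsW_insert_pin_le w hw D₂ K₂ _) hlam
    hpin

/-- **2-sum, `e,f` on side 1, marker pinned.** `(R)(D₁∪D₂; K₁∪K₂∪m; e,f)` from
`(R)(D₁; K₁ ∪ m; e,f)`. [S–W 2008 §5 Q.2, graphic case] -/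
theorem lsm_sep_same_pin (w : Sym2 V → ℝ) (hw : ∀ x, 0 ≤ w x) {D₁ K₁ D₂ K₂ : Finset (Sym2 V)}
    {S₁ S₂ : Set V} {s t : V} (e f : Sym2 V)
    (h₁ : ∀ z ∈ D₁ ∪ insert e (insert f K₁), ∀ x ∈ z, x ∈ S₁) (h₂ : ∀ z ∈ D₂ ∪ K₂, ∀ x ∈ z, x ∈ S₂)
    (hS : ∀ x, x ∈ S₁ → x ∈ S₂ → x = s ∨ x = t) (hst : s ≠ t)
    (hL₁ : ∀ z ∈ D₁ ∪ insert e (insert f K₁), ¬z.IsDiag) (hL₂ : ∀ z ∈ D₂ ∪ K₂, ¬z.IsDiag)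
    (hm₁ : s(s, t) ∉ D₁ ∪ insert e (insert f K₁)) (hm₂ : s(s, t) ∉ D₂ ∪ K₂) (hD : Disjoint D₁ D₂)
    (hpinRaw : (∑ G ∈ D₁.powerset.filter (fun G =>
        (fromEdgeSet ((G ∪ (insert e (insert f (insert s(s, t) K₁))) : Finset (Sym2 V)) : Set (Sym2 V))).IsAcyclic), ∏ x ∈ G, w x) *
      (∑ G ∈ D₁.powerset.filter (fun G =>
        (fromEdgeSet ((G ∪ (insert s(s, t) K₁) : Finset (Sym2 V)) : Set (Sym2 V))).IsAcyclic), ∏ x ∈ G, w x) ≤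
      (∑ G ∈ D₁.powerset.filter (fun G =>
        (fromEdgeSet ((G ∪ (insert e (insert s(s, t) K₁)) : Finset (Sym2 V)) : Set (Sym2 V))).IsAcyclic), ∏ x ∈ G, w x) *
      (∑ G ∈ D₁.powerset.filter (fun G =>
        (fromEdgeSet ((G ∪ (insert f (insert s(s, t) K₁)) : Finset (Sym2 V)) : Set (Sym2 V))).IsAcyclic), ∏ x ∈ G, w x)) :
    (∑ G ∈ (D₁ ∪ D₂).powerset.filter (fun G =>
        (fromEdgeSet ((G ∪ (insert e (insert f (insert s(s, t) (K₁ ∪ K₂)))) : Finset (Sym2 V)) : Set (Sym2 V))).IsAcyclic), ∏ x ∈ G, w x) *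
      (∑ G ∈ (D₁ ∪ D₂).powerset.filter (fun G =>
        (fromEdgeSet ((G ∪ (insert s(s, t) (K₁ ∪ K₂)) : Finset (Sym2 V)) : Set (Sym2 V))).IsAcyclic), ∏ x ∈ G, w x) ≤
    (∑ G ∈ (D₁ ∪ D₂).powerset.filter (fun G =>
        (fromEdgeSet ((G ∪ (insert e (insert s(s, t) (K₁ ∪ K₂))) : Finset (Sym2 V)) : Set (Sym2 V))).IsAcyclic), ∏ x ∈ G, w x) *
      (∑ G ∈ (D₁ ∪ D₂).powerset.filter (fun G =>
        (fromEdgeSet ((G ∪ (insert f (insert s(s, t) (K₁ ∪ K₂))) : Finset (Sym2 V)) : Set (Sym2 V))).IsAcyclic), ∏ x ∈ G, w x) := by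
  have hpin : (∑ G ∈ D₁.powerset.filter (fun G =>
        (fromEdgeSet ((G ∪ (insert s(s, t) (insert e (insert f K₁))) : Finset (Sym2 V)) : Set (Sym2 V))).IsAcyclic), ∏ x ∈ G, w x) *
      (∑ G ∈ D₁.powerset.filter (fun G =>
        (fromEdgeSet ((G ∪ (insert s(s, t) K₁) : Finset (Sym2 V)) : Set (Sym2 V))).IsAcyclic), ∏ x ∈ G, w x) ≤
      (∑ G ∈ D₁.powerset.filter (fun G =>
        (fromEdgeSet ((G ∪ (insert s(s, t) (insert e K₁)) : Finset (Sym2 V)) : Set (Sym2 V))).IsAcyclic), ∏ x ∈ G, w x) *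
      (∑ G ∈ D₁.powerset.filter (fun G =>
        (fromEdgeSet ((G ∪ (insert s(s, t) (insert f K₁)) : Finset (Sym2 V)) : Set (Sym2 V))).IsAcyclic), ∏ x ∈ G, w x) := by
    have e₁ : insert e (insert f (insert s(s, t) K₁)) = insert s(s, t) (insert e (insert f K₁)) := by
      ext z; simp only [Finset.mem_insert]; tauto
    have e₂ : insert e (insert s(s, t) K₁) = insert s(s, t) (insert e K₁) := Finset.insert_comm _ _ _
    have e₃ : insert f (insert s(s, t) K₁) = insert s(s, t) (insert f K₁) := Finset.insert_comm _ _ _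
    have h := hpinRaw
    simp only [e₁] at h
    simp only [e₂, e₃] at h
    exact h
  have hset₁ : insert e (insert f (insert s(s, t) (K₁ ∪ K₂))) =
      insert s(s, t) (insert e (insert f K₁) ∪ K₂) := by
    ext z; simp only [Finset.mem_insert, Finset.mem_union]; tauto
  have hset₂ : insert e (insert s(s, t) (K₁ ∪ K₂)) = insert s(s, t) (insert e K₁ ∪ K₂) := by
    ext z; simp only [Finset.mem_insert, Finset.mem_union]; tauto
  have hset₃ : insert f (insert s(s, t) (K₁ ∪ K₂)) = insert s(s, t) (insert f K₁ ∪ K₂) := by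
    ext z; simp only [Finset.mem_insert, Finset.mem_union]; tauto
  have sK : D₁ ∪ K₁ ⊆ D₁ ∪ insert e (insert f K₁) := Finset.union_subset_union (subset_refl _)
    ((Finset.subset_insert f K₁).trans (Finset.subset_insert e _))
  have sE : D₁ ∪ insert e K₁ ⊆ D₁ ∪ insert e (insert f K₁) := Finset.union_subset_union
    (subset_refl _) (Finset.insert_subset_insert e (Finset.subset_insert f K₁))
  have sF : D₁ ∪ insert f K₁ ⊆ D₁ ∪ insert e (insert f K₁) := Finset.union_subset_union
    (subset_refl _) (Finset.subset_insert e _)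
  simp only [hset₁]
  simp only [hset₂, hset₃]
  rw [forestsW_sep_pin w h₁ h₂ hS hst hL₁ hL₂
      hm₁ hm₂ hD,
    forestsW_sep_pin w (forall_mem_mono sK h₁) h₂ hS hst (forall_mem_mono sK hL₁) hL₂
      (fun h => hm₁ (sK h)) hm₂ hD,
    forestsW_sep_pin w (forall_mem_mono sE h₁) h₂ hS hst (forall_mem_mono sE hL₁) hL₂
      (fun h => hm₁ (sE h)) hm₂ hD,
    forestsW_sep_pin w (forall_mem_mono sF h₁) h₂ hS hst (forall_mem_mono sF hL₁) hL₂
      (fun h => hm₁ (sF h)) hm₂ hD]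
  exact real_sep_pin_same (forestsW_nonneg w hw D₂ _) hpin

end Summit.CriticalPhenomena.PercolationContinuityZ3.Theorems.ForestRayleigh
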